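import Summits.CriticalPhenomena.PercolationContinuityZ3.Theorems.PercNearOneGluingNoHeavyQuantConvHeavy
import HarnessLib

/-!
# QUANT lane R8, T-DEC, binder (II) `ConvClosedTResidue`: the HEAVY–HEAVY cell ⊗ cell piece is DEC at the sum of the
# ARCH credits at EVERY layer (the "top-only flipped H–H piece" of the lead's certificate rule R\*, and all its other layers)

builds on p205010 (kernel theorem, internal audit signed; external expert review pending)

Support file (`--supports stmt-CriticalPhenomena-4575`), QUANT lane seat prim-quant-arm-2 (gen 28) on the lead's explicit ask
(lane INBOX 2026-08-22T07:36Z, "→ arm-2: take ONE (II) cell — `LawDec.twoBlob_topFlipped_heavy_decAtT`"), rung R8 of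
`run/shared/lean/prim/quant/LADDER.md`; memo `run/shared/lean/prim/quant/prim-quant-lead-g25/LEAD-NOTES-G25.md` N60b/N60c.  Theorems only,
standard axioms, no sorries, no new definitions.

THE CELL.  In the lead's certificate architecture for (II) (N60c, rule R\*) the convolution of two decomposed factors is a mixture of
cell ⊗ cell pieces `P(σ, τ) = {lo₁, hi₁; γ} ∗ {lo₂, hi₂; g}`, the four-atom law
`(1−γ)(1−g)·δ_{lo₁+lo₂} + γ(1−g)·δ_{hi₁+lo₂} + (1−γ)g·δ_{lo₁+hi₂} + γg·δ_{hi₁+hi₂}`; with `s = lo₁ + lo₂`, `A = hi₁ − lo₁`, `B = hi₂ − lo₂`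
this is the two-blob law `LAW2[A, γ; B, g]` shifted by `s`.  For two HEAVY cells (`x ≤ γ, g ≤ 1`) the piece must be certified ALONE at the
sum of the two (N)-credits, `2lo₁ + Aγ + 2lo₂ + Bg = 2s + Aγ + Bg`; the lead's exact LP found 0 failures in 59 400 "top-only flipped"
instances (`explore/topflip.py`).  HERE: it is DEC(j) at that target at EVERY layer `j` (so the certificate needs no layer case split for
H–H pieces): for `j ≥ s` by census-2 g51/g52's BLOB-DEC(2) (`BlobDec2.decAt_all`: `LAW2` is DEC at its mean `Aγ + Bg` at every layer) and
census-2 g53's shift lemma with the double target bonus (`decAtT_shift_two`: `+2s`); for `j < s` every atom is a giant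
(`decAtT_of_allGiants`).  HONEST NOVELTY: none in substance — the case `s + A ≤ j` is typer g22's `slice_heavyPair_decAtT`
(`…QuantSliceHeavy`, whose proof is exactly this and uses `hi ≤ j′` only through `lo ≤ j′`) and the `SH`-form with a heavy datum is
`shift_heavyPair_decAtT` (`…QuantConvHeavy`); this file packages the cell in the four vocabularies the (II) certificate uses, with the
layer hypothesis removed.  The lead's side conditions `s + A ≤ j`, `s + B ≤ j < s + A + B` ("only the top flipped") are NOT needed.

* **`LawDec.twoBlobShift_heavy_decAtT`** — shifted-`LAW2` form, any target `T′ ≤ 2s + AG + Bg`, any top `M ≥ s + A + B`, every layer.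
* **`LawDec.twoBlob_topFlipped_heavy_decAtT`** — the lead's working name and binder: target `2s + A·G + B·g`, top `s + A + B`, every layer.
* **`LawDec.heavyPairPiece_decAtT`** — the explicit four-atom form in the cells' `lo/hi` coordinates.
* **`LawDec.lconv_heavyPairs_decAtT`** — the piece as `lconv M₁ M₂ {lo₁, hi₁; γ} {lo₂, hi₂; g}` (census-2 g53's `LawDec.lconv`).
* **`LawDec.shift_heavyPairs_decAtT`** — the piece in the `SH`-mixture form `(1−g)·shift_{lo₂} + g·shift_{hi₂}` of `lconv_TP`.
* **`LawDec.slice_heavyPair_decAtT_allLayers`** — `slice_heavyPair_decAtT` without the hypothesis `hi ≤ j′`.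

[this work]; DEC rules ARCH-TREES-G49 §2.2 / DEC-TAMP-G50 §3.1, BLOB-DEC2-G51, LEAD-NOTES-G25 N60b/N60c (this lane).  The gluing rows served
[cite: KozmaNitzan2024, Conjecture 3 (p. 15)]; product measure [cite: Grimmett1999, §1.3 p. 10].
-/

noncomputable section

namespace Summit.CriticalPhenomena.PercolationContinuityZ3.Theorems

namespace Quant

open Finset

/-- the two-point law `{lo, hi; g}` (as in `…QuantLawDEC`) -/
local notation3 "TP[" lo ", " hi ", " g ", " h "]" =>
  (g : ℝ) * (if (h : ℕ) = (hi : ℕ) then (1 : ℝ) else 0) + (1 - (g : ℝ)) * (if (h : ℕ) = (lo : ℕ) then (1 : ℝ) else 0)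

/-- the law `μ` shifted up by `s` (as in `…QuantConvHeavy`) -/
local notation3 "SH[" μ ", " s ", " h "]" => (if (s : ℕ) ≤ (h : ℕ) then (μ : ℕ → ℝ) ((h : ℕ) - (s : ℕ)) else (0 : ℝ))

/-- the two-blob law `(1−u)(1−v)δ₀ + u(1−v)δ_a + (1−u)vδ_b + uvδ_{a+b}` evaluated at `h` (as in `…QuantBlobDecTwoLawParts`) -/
local notation3 "LAW2[" a ", " u ", " b ", " v ", " h "]" =>
  (1 - (u : ℝ)) * (1 - (v : ℝ)) * (if (h : ℕ) = 0 then (1 : ℝ) else 0)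
    + (u : ℝ) * (1 - (v : ℝ)) * (if (h : ℕ) = (a : ℕ) then (1 : ℝ) else 0)
    + (1 - (u : ℝ)) * (v : ℝ) * (if (h : ℕ) = (b : ℕ) then (1 : ℝ) else 0)
    + (u : ℝ) * (v : ℝ) * (if (h : ℕ) = (a : ℕ) + (b : ℕ) then (1 : ℝ) else 0)

namespace LawDec

/-! ### The shifted heavy two-blob law is DEC at the credit target at every layer -/

/-- **THE H–H PIECE, shifted-`LAW2` form, EVERY LAYER.**  Floor `0 < x < 1`, heavy gates `x ≤ G ≤ 1`, `x ≤ g ≤ 1`, sizes `A, B ≥ 1`,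
shift `s`, any top `M ≥ s + A + B`, any target `T′ ≤ 2s + A·G + B·g` and ANY layer `j`: the law `h ↦ LAW2[A, G; B, g](h − s)·[s ≤ h]`
(atoms `s, s+A, s+B, s+A+B` with masses `(1−G)(1−g), G(1−g), (1−G)g, Gg`) is `DECAtT x T′ j M`.  For `j ≥ s`: BLOB-DEC(2) at layer
`j − s` at the mean `AG + Bg` (`BlobDec2.decAt_all`, `BlobDec2.law_mean`), shifted by `s` with the double bonus (`decAtT_shift_two`), top
raised and target lowered; for `j < s`: all atoms are giants (`decAtT_of_allGiants`). [this work] -/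
theorem twoBlobShift_heavy_decAtT (x G g T' : ℝ) (s A B j M : ℕ) (hx0 : 0 < x) (hx1 : x < 1)
    (hxG : x ≤ G) (hG1 : G ≤ 1) (hxg : x ≤ g) (hg1 : g ≤ 1) (hA : 1 ≤ A) (hB : 1 ≤ B) (hM : s + A + B ≤ M)
    (hT' : T' ≤ 2 * (s : ℝ) + (A : ℝ) * G + (B : ℝ) * g) :
    DECAtT x T' j M (fun h => if s ≤ h then LAW2[A, G, B, g, h - s] else 0) := by
  classical
  by_cases hsj : s ≤ j
  · -- BLOB-DEC(2) at layer `j - s`, at the mean, then shift by `s`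
    have hdec := BlobDec2.decAt_all A B (j - s) G g x hA hB hx0 hx1 hxG hG1 hxg hg1
    rw [decAt_iff_decAtT, BlobDec2.law_mean] at hdec
    have hsh := decAtT_shift_two x ((A : ℝ) * G + (B : ℝ) * g) (j - s) (A + B) s _ hdec
    rw [show j - s + s = j by omega] at hsh
    exact decAtT_antitone_target (by linarith) (decAtT_mono_top hsh (by omega))
  · -- `j < s`: the law vanishes on `{0..j}`
    have hG0 : 0 ≤ G := hx0.le.trans hxG
    have hg0 : 0 ≤ g := hx0.le.trans hxg
    refine decAtT_of_allGiants x T' j M _ hx0 hx1 (fun h => ?_) (fun h hh => ?_) ?_ (fun h hh => ?_)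
    · by_cases hsh : s ≤ h
      · rw [if_pos hsh]; exact BlobDec2.law_nonneg A B G g hG0 hG1 hg0 hg1 _
      · rw [if_neg hsh]
    · rw [if_pos (by omega)]
      exact BlobDec2.law_eq_zero_of_lt A B G g (h - s) (by omega)
    · exact sum_shift_range (fun h => LAW2[A, G, B, g, h]) (A + B) s M
        (fun h hh => BlobDec2.law_eq_zero_of_lt A B G g h hh) (BlobDec2.law_mass A B G g) (by omega)
    · rw [if_neg (by omega)]

/-- **THE LEAD'S CELL `twoBlob_topFlipped_heavy_decAtT` (working name of the ask, lane INBOX 2026-08-22T07:36Z): for `0 < x < 1`, gates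
`x ≤ G ≤ 1`, `x ≤ g ≤ 1`, sizes `A, B ≥ 1` and a shift `s`, the shifted two-blob law `{s: (1−G)(1−g), s+A: G(1−g), s+B: (1−G)g, s+A+B: Gg}`
is `DECAtT x (2s + A·G + B·g) j (s + A + B)` — at EVERY layer `j`** (the "only the top flipped" side conditions `s + A ≤ j`,
`s + B ≤ j < s + A + B` of rule R\* are not needed; N60c (2), H–H: 59 400 / 0 exact-LP instances). [this work] -/
theorem twoBlob_topFlipped_heavy_decAtT (x G g : ℝ) (s A B j : ℕ) (hx0 : 0 < x) (hx1 : x < 1)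
    (hxG : x ≤ G) (hG1 : G ≤ 1) (hxg : x ≤ g) (hg1 : g ≤ 1) (hA : 1 ≤ A) (hB : 1 ≤ B) :
    DECAtT x (2 * (s : ℝ) + (A : ℝ) * G + (B : ℝ) * g) j (s + A + B) (fun h => if s ≤ h then LAW2[A, G, B, g, h - s] else 0) :=
  twoBlobShift_heavy_decAtT x G g _ s A B j (s + A + B) hx0 hx1 hxG hG1 hxg hg1 hA hB le_rfl le_rfl

/-! ### The same cell in the certificate's other vocabularies -/

/-- **THE H–H PIECE, four-atom form in cell coordinates.**  Heavy cells `{lo₁, hi₁; γ}` (`lo₁ < hi₁`, `x ≤ γ ≤ 1`) and `{lo₂, hi₂; g}`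
(`lo₂ < hi₂`, `x ≤ g ≤ 1`), floor `0 < x < 1`, any top `M ≥ hi₁ + hi₂`, any target `T′ ≤ (2lo₁ + (hi₁−lo₁)γ) + (2lo₂ + (hi₂−lo₂)g)`
(the sum of the two (N)-credits) and ANY layer `j′`: the piece `(1−γ)(1−g)δ_{lo₁+lo₂} + γ(1−g)δ_{hi₁+lo₂} + (1−γ)gδ_{lo₁+hi₂} + γgδ_{hi₁+hi₂}`
is `DECAtT x T′ j′ M` (`twoBlobShift_heavy_decAtT` with `s = lo₁ + lo₂`, `A = hi₁ − lo₁`, `B = hi₂ − lo₂`). [this work] -/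
theorem heavyPairPiece_decAtT (x T' γ g : ℝ) (j' M lo₁ hi₁ lo₂ hi₂ : ℕ) (hx0 : 0 < x) (hx1 : x < 1)
    (hxγ : x ≤ γ) (hγ1 : γ ≤ 1) (hxg : x ≤ g) (hg1 : g ≤ 1) (h₁ : lo₁ < hi₁) (h₂ : lo₂ < hi₂) (hM : hi₁ + hi₂ ≤ M)
    (hT' : T' ≤ 2 * (lo₁ : ℝ) + ((hi₁ : ℝ) - lo₁) * γ + (2 * (lo₂ : ℝ) + ((hi₂ : ℝ) - lo₂) * g)) :
    DECAtT x T' j' M (fun h => (1 - γ) * (1 - g) * (if h = lo₁ + lo₂ then (1 : ℝ) else 0)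
      + γ * (1 - g) * (if h = hi₁ + lo₂ then (1 : ℝ) else 0)
      + (1 - γ) * g * (if h = lo₁ + hi₂ then (1 : ℝ) else 0)
      + γ * g * (if h = hi₁ + hi₂ then (1 : ℝ) else 0)) := by
  classical
  obtain ⟨A, hA⟩ : ∃ A, hi₁ = lo₁ + A := ⟨hi₁ - lo₁, by omega⟩
  obtain ⟨B, hB⟩ : ∃ B, hi₂ = lo₂ + B := ⟨hi₂ - lo₂, by omega⟩
  have hT'' : T' ≤ 2 * ((lo₁ + lo₂ : ℕ) : ℝ) + (A : ℝ) * γ + (B : ℝ) * g := by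
    have e1 : ((hi₁ : ℝ) - lo₁) = A := by rw [hA]; push_cast; ring
    have e2 : ((hi₂ : ℝ) - lo₂) = B := by rw [hB]; push_cast; ring
    rw [e1, e2] at hT'
    push_cast
    linarith
  have hmain := twoBlobShift_heavy_decAtT x γ g T' (lo₁ + lo₂) A B j' M hx0 hx1 hxγ hγ1 hxg hg1 (by omega) (by omega)
    (by omega) hT''
  have e : (fun h => if lo₁ + lo₂ ≤ h then LAW2[A, γ, B, g, h - (lo₁ + lo₂)] else 0)
      = fun h => (1 - γ) * (1 - g) * (if h = lo₁ + lo₂ then (1 : ℝ) else 0)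
          + γ * (1 - g) * (if h = hi₁ + lo₂ then (1 : ℝ) else 0)
          + (1 - γ) * g * (if h = lo₁ + hi₂ then (1 : ℝ) else 0)
          + γ * g * (if h = hi₁ + hi₂ then (1 : ℝ) else 0) := by
    funext h
    by_cases hs : lo₁ + lo₂ ≤ h
    · rw [if_pos hs]
      have e0 : (h - (lo₁ + lo₂) = 0) ↔ (h = lo₁ + lo₂) := by omega
      have eA : (h - (lo₁ + lo₂) = A) ↔ (h = hi₁ + lo₂) := by omega
      have eB : (h - (lo₁ + lo₂) = B) ↔ (h = lo₁ + hi₂) := by omega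
      have eAB : (h - (lo₁ + lo₂) = A + B) ↔ (h = hi₁ + hi₂) := by omega
      simp only [e0, eA, eB, eAB]
    · rw [if_neg hs, if_neg (by omega), if_neg (by omega), if_neg (by omega), if_neg (by omega)]
      ring
  rw [e] at hmain
  exact hmain

/-- a two-point law `{lo, hi; γ}` with `lo ≤ hi ≤ M` vanishes above `M`. [this work] -/
theorem TP_eq_zero_of_top_lt (lo hi M : ℕ) (γ : ℝ) (hlohi : lo ≤ hi) (hhi : hi ≤ M) (h : ℕ) (hh : M < h) :
    TP[lo, hi, γ, h] = 0 := by
  rw [if_neg (by omega), if_neg (by omega)]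
  ring

/-- **the `SH`-mixture of a cell by a cell is the four-atom piece**: `(1−g)·shift_{lo₂}{lo₁, hi₁; γ} + g·shift_{hi₂}{lo₁, hi₁; γ}`
evaluated at `h`. [this work] -/
theorem shift_TP_pair_eq (γ g : ℝ) (lo₁ hi₁ lo₂ hi₂ h : ℕ) (h₂ : lo₂ ≤ hi₂) :
    (1 - g) * SH[(fun t => TP[lo₁, hi₁, γ, t]), lo₂, h] + g * SH[(fun t => TP[lo₁, hi₁, γ, t]), hi₂, h]
      = (1 - γ) * (1 - g) * (if h = lo₁ + lo₂ then (1 : ℝ) else 0)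
          + γ * (1 - g) * (if h = hi₁ + lo₂ then (1 : ℝ) else 0)
          + (1 - γ) * g * (if h = lo₁ + hi₂ then (1 : ℝ) else 0)
          + γ * g * (if h = hi₁ + hi₂ then (1 : ℝ) else 0) := by
  by_cases hl : lo₂ ≤ h
  · have e1 : (h - lo₂ = hi₁) ↔ (h = hi₁ + lo₂) := by omega
    have e2 : (h - lo₂ = lo₁) ↔ (h = lo₁ + lo₂) := by omega
    by_cases hh : hi₂ ≤ h
    · have e3 : (h - hi₂ = hi₁) ↔ (h = hi₁ + hi₂) := by omega
      have e4 : (h - hi₂ = lo₁) ↔ (h = lo₁ + hi₂) := by omega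
      simp only [hl, hh, if_true, e1, e2, e3, e4]
      ring
    · have n3 : ¬ h = lo₁ + hi₂ := by omega
      have n4 : ¬ h = hi₁ + hi₂ := by omega
      simp only [hl, hh, if_true, if_false, e1, e2, n3, n4]
      ring
  · have hh : ¬ hi₂ ≤ h := by omega
    have n1 : ¬ h = lo₁ + lo₂ := by omega
    have n2 : ¬ h = hi₁ + lo₂ := by omega
    have n3 : ¬ h = lo₁ + hi₂ := by omega
    have n4 : ¬ h = hi₁ + hi₂ := by omega
    simp only [hl, hh, if_false, n1, n2, n3, n4]
    ring

/-- **THE H–H PIECE in the `SH`-mixture form of `lconv_TP`** (`…QuantConvHeavy`/`…QuantConvWindow` write the terms of a convolution as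
`(1−g)·shift_{lo₂} μ₁ + g·shift_{hi₂} μ₁`): for `μ₁` the heavy cell `{lo₁, hi₁; γ}` and a heavy cell `{lo₂, hi₂; g}` of the other factor,
DEC at every layer at every target `≤` the sum of the two (N)-credits, on any `{0..M}` with `hi₁ + hi₂ ≤ M`. [this work] -/
theorem shift_heavyPairs_decAtT (x T' γ g : ℝ) (j' M lo₁ hi₁ lo₂ hi₂ : ℕ) (hx0 : 0 < x) (hx1 : x < 1)
    (hxγ : x ≤ γ) (hγ1 : γ ≤ 1) (hxg : x ≤ g) (hg1 : g ≤ 1) (h₁ : lo₁ < hi₁) (h₂ : lo₂ < hi₂) (hM : hi₁ + hi₂ ≤ M)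
    (hT' : T' ≤ 2 * (lo₁ : ℝ) + ((hi₁ : ℝ) - lo₁) * γ + (2 * (lo₂ : ℝ) + ((hi₂ : ℝ) - lo₂) * g)) :
    DECAtT x T' j' M
      (fun h => (1 - g) * SH[(fun t => TP[lo₁, hi₁, γ, t]), lo₂, h] + g * SH[(fun t => TP[lo₁, hi₁, γ, t]), hi₂, h]) := by
  have e : (fun h => (1 - g) * SH[(fun t => TP[lo₁, hi₁, γ, t]), lo₂, h] + g * SH[(fun t => TP[lo₁, hi₁, γ, t]), hi₂, h])
      = fun h => (1 - γ) * (1 - g) * (if h = lo₁ + lo₂ then (1 : ℝ) else 0)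
          + γ * (1 - g) * (if h = hi₁ + lo₂ then (1 : ℝ) else 0)
          + (1 - γ) * g * (if h = lo₁ + hi₂ then (1 : ℝ) else 0)
          + γ * g * (if h = hi₁ + hi₂ then (1 : ℝ) else 0) :=
    funext fun h => shift_TP_pair_eq γ g lo₁ hi₁ lo₂ hi₂ h h₂.le
  rw [e]
  exact heavyPairPiece_decAtT x T' γ g j' M lo₁ hi₁ lo₂ hi₂ hx0 hx1 hxγ hγ1 hxg hg1 h₁ h₂ hM hT'

/-- **THE H–H PIECE as a convolution of two cells** (census-2 g53's `LawDec.lconv`): for heavy cells `{lo₁, hi₁; γ}` on `{0..M₁}` and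
`{lo₂, hi₂; g}` on `{0..M₂}` (`lo_i < hi_i ≤ M_i`, `x ≤ γ, g ≤ 1`), floor `0 < x < 1`, EVERY layer `j′` and every target
`T′ ≤ (2lo₁ + (hi₁−lo₁)γ) + (2lo₂ + (hi₂−lo₂)g)`: `DECAtT x T′ j′ (M₁ + M₂) (lconv M₁ M₂ {lo₁, hi₁; γ} {lo₂, hi₂; g})`. [this work] -/
theorem lconv_heavyPairs_decAtT (x T' γ g : ℝ) (j' M₁ M₂ lo₁ hi₁ lo₂ hi₂ : ℕ) (hx0 : 0 < x) (hx1 : x < 1)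
    (hxγ : x ≤ γ) (hγ1 : γ ≤ 1) (hxg : x ≤ g) (hg1 : g ≤ 1) (h₁ : lo₁ < hi₁) (hM₁ : hi₁ ≤ M₁) (h₂ : lo₂ < hi₂) (hM₂ : hi₂ ≤ M₂)
    (hT' : T' ≤ 2 * (lo₁ : ℝ) + ((hi₁ : ℝ) - lo₁) * γ + (2 * (lo₂ : ℝ) + ((hi₂ : ℝ) - lo₂) * g)) :
    DECAtT x T' j' (M₁ + M₂) (lconv M₁ M₂ (fun t => TP[lo₁, hi₁, γ, t]) (fun t => TP[lo₂, hi₂, g, t])) := by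
  have e : lconv M₁ M₂ (fun t => TP[lo₁, hi₁, γ, t]) (fun t => TP[lo₂, hi₂, g, t])
      = fun h => (1 - g) * SH[(fun t => TP[lo₁, hi₁, γ, t]), lo₂, h] + g * SH[(fun t => TP[lo₁, hi₁, γ, t]), hi₂, h] :=
    funext fun h => lconv_TP M₁ M₂ lo₂ hi₂ (fun t => TP[lo₁, hi₁, γ, t]) g
      (fun t ht => TP_eq_zero_of_top_lt lo₁ hi₁ M₁ γ h₁.le hM₁ t ht) (h₂.le.trans hM₂) hM₂ h
  rw [e]
  exact shift_heavyPairs_decAtT x T' γ g j' (M₁ + M₂) lo₁ hi₁ lo₂ hi₂ hx0 hx1 hxγ hγ1 hxg hg1 h₁ h₂ (by omega) hT'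

/-- **`slice_heavyPair_decAtT` AT EVERY LAYER**: typer g22's heavy (N)-piece of the slice (`…QuantSliceHeavy`) without its hypothesis
`hi ≤ j′` — the slice of a heavy pair `{lo, hi; γ}` (`lo < hi ≤ M`, `x ≤ γ ≤ 1`) by a heavy blob `(a ≥ 1, x ≤ g ≤ 1)` is DEC(j′) at
every target `T′ ≤ 2lo + (hi−lo)γ + a·g`, for every `j′`. [this work] -/
theorem slice_heavyPair_decAtT_allLayers (x T' g γ : ℝ) (j' M lo hi a : ℕ) (hx0 : 0 < x) (hx1 : x < 1) (hxg : x ≤ g)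
    (hg1 : g ≤ 1) (hxγ : x ≤ γ) (hγ1 : γ ≤ 1) (ha : 1 ≤ a) (hlt : lo < hi) (hhi : hi ≤ M)
    (hT' : T' ≤ 2 * (lo : ℝ) + ((hi : ℝ) - lo) * γ + (a : ℝ) * g) :
    DECAtT x T' j' (M + a) (slice (fun t => TP[lo, hi, γ, t]) a g) := by
  have e : slice (fun t => TP[lo, hi, γ, t]) a g
      = fun h => (1 - γ) * (1 - g) * (if h = lo + 0 then (1 : ℝ) else 0)
          + γ * (1 - g) * (if h = hi + 0 then (1 : ℝ) else 0)
          + (1 - γ) * g * (if h = lo + a then (1 : ℝ) else 0)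
          + γ * g * (if h = hi + a then (1 : ℝ) else 0) := by
    funext h
    rw [slice_TP, Nat.add_zero, Nat.add_zero]
    ring
  rw [e]
  exact heavyPairPiece_decAtT x T' γ g j' (M + a) lo hi 0 a hx0 hx1 hxγ hγ1 hxg hg1 hlt (by omega) (by omega)
    (by push_cast; linarith)

end LawDec

end Quant

end Summit.CriticalPhenomena.PercolationContinuityZ3.Theorems
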